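import Summits.BirchSwinnertonDyer.BirchSwinnertonDyer.Theorems.KimAtThreeD7uTamagawaFreePlaces
import HarnessLib

/-!
# The TAMAGAWA-DIVISIBLE bad places, I: the `p`-divisible CORE of `E[p^∞]^{I_v}`
# (`= π(T_pE^{I_v} ⊗ ℚ_p/ℤ_p)`) and `π_n(T_pE^{I_v}) = core[p^n]`
# (cell `bsd-addord`, seat w2-tamdiv gen 4; route W2 `KimAtThreeKolyvagin`, items 19562 / 19560, «TamDiv∞»,
# POSITIVE exponent)

HONEST FRAMING: TOOL theorems (no definition, no named fact, no `sorry`); closes nothing by itself;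
nothing is booked; BSD is not proved by any of this.  Gens 2/3 of this seat landed [MR04] Remark A.5 for
`T_pE` (`𝓕_u ≤ 𝓕_can`, Kato-type classes are Kolyvagin systems for `𝓕_u`) and the EXPONENT-ZERO case of
the Tamagawa index (`p ∤ c_w ⇒ 𝓕_u(w) = 𝓕_can(w)`); the honest limit of record (HOME
`w2-tamdiv/W2-TAMDIV-TAMFREE-g3.md` §3, acc5 g3 `KimAtThreeDeepUpperOffStratumLocalIndex`) is the E-SPECIFIC
positive-exponent index `[𝓕_can(w) : 𝓕_u(w)] = #Φ_w[p^{k+1}]` (Rubin, *Euler Systems*, Lemma 1.3.5;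
Büyükboduk, JNT 129 (2009) §2.1.2 Remark 2; [MR04] Prop. 6.2.6).  This file is the first of the local
algebra files proving it, in TORSION currency only (no Lang, no Tate uniformisation, every reduction type,
every `p ≠ char`).

## What (any number field `K`, `𝔓₀ = adicCompletionPrime K v`, `I = I_{𝔓₀}`)

The CORE of `N = E[p^∞]^{I}` is the set of `x` having `I`-fixed `p^k`-th roots for every `k`
(written out as a predicate; for `N ≅ (ℚ_p/ℤ_p)^a ⊕ F` it is the maximal divisible subgroup — the
`E₀`-part, Grothendieck SGA 7 IX §11).
* §1 `core_*`: the core is an `I`-fixed, `D_{𝔓₀}`-stable subgroup, `p`-DIVISIBLE inside itself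
  (`exists_core_nsmul_eq_of_core`, n1011 `exists_nsmul_eq_of_forall_exists_pow_nsmul_eq`), with compatible
  root sequences (`exists_divSeq_of_core`).
* §2 `exists_tate_proj_eq_of_core` / `core_proj_of_inertia_smul_eq`: **`π_n(T_pE^{I}) = core[p^n]`** —
  the level-`n` values of `I`-fixed Tate vectors are exactly the core points killed by `p^n`.

Sequels: `KimAtThreeD7uTamagawaCoreFrobenius` (`φ − 1` is ONTO the core, `H¹(⟨φ⟩, core) = 0`),
`KimAtThreeD7uTamagawaComponent` (core = `E₀`-part; `(N/core)^{φ} ≅ Φ_v[p^∞]`, order `(c_v)_p`),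
`KimAtThreeD7uTamagawaIndex` (`#𝓕_can(w)_k = #𝓕_u(w)_k · #Φ_w[p^{k+1}]` over `ℚ`).
References: K. Rubin, *Euler Systems* (2000) Lemma 1.3.2, 1.3.5; B. Mazur, K. Rubin, Mem. AMS 799 (2004)
Prop. 6.2.6, Remark A.5; K. Büyükboduk, JNT 129 (2009) §2.1.2 Remark 2, Thm. 3.1; A. Grothendieck, SGA 7 I,
Exp. IX §11; R. Greenberg, LNM 1716 (1999) §3 Lemma 3.3; J. S. Milne, *ADT* I Prop. 3.8.
-/

noncomputable section

-- the cell's Theorems namespace `Summit.BirchSwinnertonDyer.BirchSwinnertonDyer.…` repeats the summit name by design (D-0017)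
set_option linter.dupNamespace false

open Function Field IsDedekindDomain NumberField
open scoped NumberField Classical
open Literature.NumberTheory.GaloisRepresentations Literature.NumberTheory.EllipticCurves
open WeierstrassCurve
open Summit.BirchSwinnertonDyer.Rank1Residual.GaloisImage
open Summit.BirchSwinnertonDyer.Rank1Residual.GaloisImage.InertiaDivisible

namespace Summit.BirchSwinnertonDyer.BirchSwinnertonDyer.Theorems.KimAtThreeD7uTamagawaCore

variable {K : Type} [Field K] [NumberField K] (W : WeierstrassCurve K) [W.IsElliptic] (p : ℕ)
  [hp : Fact p.Prime]

/-! ### §1 The `p`-divisible core of `E[p^∞]^{I}`: a `D`-stable `I`-fixed divisible subgroup -/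

section Core

variable {v : HeightOneSpectrum (𝓞 K)}

omit [W.IsElliptic] hp in
/-- A core point (one with `I`-fixed `p^k`-th roots for every `k`) is `I`-fixed (`k = 0`). [folklore] -/
theorem smul_eq_of_core {x : W.geomPrimaryTorsion p}
    (hx : ∀ k : ℕ, ∃ y : W.geomPrimaryTorsion p,
      (∀ i ∈ (adicCompletionPrime K v).inertia (absoluteGaloisGroup K), i • y = y) ∧ p ^ k • y = x)
    {i : absoluteGaloisGroup K} (hi : i ∈ (adicCompletionPrime K v).inertia (absoluteGaloisGroup K)) :
    i • x = x := by
  obtain ⟨y, hyI, hy⟩ := hx 0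
  rw [pow_zero, one_smul] at hy
  rw [← hy]; exact hyI i hi

omit [W.IsElliptic] hp in
/-- `0` is a core point. [folklore] -/
theorem core_zero :
    ∀ k : ℕ, ∃ y : W.geomPrimaryTorsion p,
      (∀ i ∈ (adicCompletionPrime K v).inertia (absoluteGaloisGroup K), i • y = y) ∧
        p ^ k • y = (0 : W.geomPrimaryTorsion p) :=
  fun _ => ⟨0, fun i _ => smul_zero i, smul_zero _⟩

omit [W.IsElliptic] hp in
/-- Core points form an additive subgroup: sums. [folklore] -/
theorem core_add {x x' : W.geomPrimaryTorsion p}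
    (hx : ∀ k : ℕ, ∃ y : W.geomPrimaryTorsion p,
      (∀ i ∈ (adicCompletionPrime K v).inertia (absoluteGaloisGroup K), i • y = y) ∧ p ^ k • y = x)
    (hx' : ∀ k : ℕ, ∃ y : W.geomPrimaryTorsion p,
      (∀ i ∈ (adicCompletionPrime K v).inertia (absoluteGaloisGroup K), i • y = y) ∧ p ^ k • y = x') :
    ∀ k : ℕ, ∃ y : W.geomPrimaryTorsion p,
      (∀ i ∈ (adicCompletionPrime K v).inertia (absoluteGaloisGroup K), i • y = y) ∧
        p ^ k • y = x + x' := by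
  intro k
  obtain ⟨y, hyI, hy⟩ := hx k
  obtain ⟨y', hy'I, hy'⟩ := hx' k
  exact ⟨y + y', fun i hi => by rw [smul_add, hyI i hi, hy'I i hi], by rw [smul_add, hy, hy']⟩

omit [W.IsElliptic] hp in
/-- Core points form an additive subgroup: negatives. [folklore] -/
theorem core_neg {x : W.geomPrimaryTorsion p}
    (hx : ∀ k : ℕ, ∃ y : W.geomPrimaryTorsion p,
      (∀ i ∈ (adicCompletionPrime K v).inertia (absoluteGaloisGroup K), i • y = y) ∧ p ^ k • y = x) :
    ∀ k : ℕ, ∃ y : W.geomPrimaryTorsion p,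
      (∀ i ∈ (adicCompletionPrime K v).inertia (absoluteGaloisGroup K), i • y = y) ∧
        p ^ k • y = -x := by
  intro k
  obtain ⟨y, hyI, hy⟩ := hx k
  exact ⟨-y, fun i hi => by rw [smul_neg, hyI i hi], by rw [smul_neg, hy]⟩

omit [W.IsElliptic] hp in
/-- Core points form an additive subgroup: differences. [folklore] -/
theorem core_sub {x x' : W.geomPrimaryTorsion p}
    (hx : ∀ k : ℕ, ∃ y : W.geomPrimaryTorsion p,
      (∀ i ∈ (adicCompletionPrime K v).inertia (absoluteGaloisGroup K), i • y = y) ∧ p ^ k • y = x)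
    (hx' : ∀ k : ℕ, ∃ y : W.geomPrimaryTorsion p,
      (∀ i ∈ (adicCompletionPrime K v).inertia (absoluteGaloisGroup K), i • y = y) ∧ p ^ k • y = x') :
    ∀ k : ℕ, ∃ y : W.geomPrimaryTorsion p,
      (∀ i ∈ (adicCompletionPrime K v).inertia (absoluteGaloisGroup K), i • y = y) ∧
        p ^ k • y = x - x' := by
  have h := core_add W p hx (core_neg W p hx')
  rwa [← sub_eq_add_neg] at h

omit [W.IsElliptic] hp in
/-- **The core is stable under the decomposition group** (`I_{𝔓₀}` is normal in `D_{𝔓₀}`):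
`d • x` is a core point if `x` is, for `d ∈ D_{𝔓₀}`. [cite: NeukirchANT1999, Ch. I §9 (9.6)] -/
theorem core_smul_of_mem_decompositionSubgroup {x : W.geomPrimaryTorsion p}
    (hx : ∀ k : ℕ, ∃ y : W.geomPrimaryTorsion p,
      (∀ i ∈ (adicCompletionPrime K v).inertia (absoluteGaloisGroup K), i • y = y) ∧ p ^ k • y = x)
    {d : absoluteGaloisGroup K}
    (hd : d ∈ (adicCompletionPrime K v).decompositionSubgroup (absoluteGaloisGroup K)) :
    ∀ k : ℕ, ∃ y : W.geomPrimaryTorsion p,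
      (∀ i ∈ (adicCompletionPrime K v).inertia (absoluteGaloisGroup K), i • y = y) ∧
        p ^ k • y = d • x := by
  intro k
  obtain ⟨y, hyI, hy⟩ := hx k
  refine ⟨d • y, fun i hi => ?_, by rw [smul_comm, hy]⟩
  have hi' : d⁻¹ * i * d ∈ (adicCompletionPrime K v).inertia (absoluteGaloisGroup K) :=
    inv_mul_mul_mem_inertia_adicCompletionPrime v hd hi
  have e : i • d • y = d • ((d⁻¹ * i * d) • y) := by
    rw [← mul_smul, ← mul_smul]; congr 1; group
  rw [e, hyI _ hi']


/-- **The core is `p`-divisible inside itself** (`E[p]` finite): a core point is `p • y` for a core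
point `y` — n1011's divisible-core lemma `exists_nsmul_eq_of_forall_exists_pow_nsmul_eq` for the
subgroup `N = E[p^∞]^{I}`.
[cite: GreenbergLNM1716, §3 Lemma 3.3 (p. 87) with the remark after its proof (p. 88)] -/
theorem exists_core_nsmul_eq_of_core {x : W.geomPrimaryTorsion p}
    (hx : ∀ k : ℕ, ∃ y : W.geomPrimaryTorsion p,
      (∀ i ∈ (adicCompletionPrime K v).inertia (absoluteGaloisGroup K), i • y = y) ∧ p ^ k • y = x) :
    ∃ y : W.geomPrimaryTorsion p,
      (∀ k : ℕ, ∃ z : W.geomPrimaryTorsion p,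
        (∀ i ∈ (adicCompletionPrime K v).inertia (absoluteGaloisGroup K), i • z = z) ∧ p ^ k • z = y) ∧
      p • y = x := by
  set I : Subgroup (absoluteGaloisGroup K) := (adicCompletionPrime K v).inertia (absoluteGaloisGroup K)
    with hIdef
  let N : AddSubgroup (W.geomPrimaryTorsion p) :=
    { carrier := {x | ∀ i ∈ I, i • x = x}
      add_mem' := fun {a b} ha hb i hi ↦ by rw [smul_add, ha i hi, hb i hi]
      zero_mem' := fun i _ ↦ smul_zero i
      neg_mem' := fun {a} ha i hi ↦ by rw [smul_neg, ha i hi] }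
  have hNmem : ∀ x : W.geomPrimaryTorsion p, x ∈ N ↔ ∀ i ∈ I, i • x = x := fun _ ↦ Iff.rfl
  have hfin := KimAtThreeD7uTamagawaFreePlaces.finite_setOf_smul_eq_zero_geomPrimaryTorsion W p
  have hx' : ∀ k : ℕ, ∃ y ∈ N, p ^ k • y = x := fun k => by
    obtain ⟨y, hyI, hy⟩ := hx k
    exact ⟨y, (hNmem y).mpr hyI, hy⟩
  obtain ⟨y, -, hpy, hy⟩ := exists_nsmul_eq_of_forall_exists_pow_nsmul_eq N hfin hx'
  exact ⟨y, fun k => by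
    obtain ⟨z, hzN, hz⟩ := hy k
    exact ⟨z, (hNmem z).mp hzN, hz⟩, hpy⟩


/-- **Compatible root sequences in the core**: a core point `x` has a sequence `s` with `s 0 = x`,
`p • s (n+1) = s n`, every `s n` a core point (recursive choice along `exists_core_nsmul_eq_of_core`).
[cite: GreenbergLNM1716, §3 Lemma 3.3 (p. 87) with the remark after its proof (p. 88)] -/
theorem exists_divSeq_of_core {x : W.geomPrimaryTorsion p}
    (hx : ∀ k : ℕ, ∃ y : W.geomPrimaryTorsion p,
      (∀ i ∈ (adicCompletionPrime K v).inertia (absoluteGaloisGroup K), i • y = y) ∧ p ^ k • y = x) :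
    ∃ s : ℕ → W.geomPrimaryTorsion p, s 0 = x ∧ (∀ n, p • s (n + 1) = s n) ∧
      ∀ n, ∀ k : ℕ, ∃ y : W.geomPrimaryTorsion p,
        (∀ i ∈ (adicCompletionPrime K v).inertia (absoluteGaloisGroup K), i • y = y) ∧
          p ^ k • y = s n := by
  let P : W.geomPrimaryTorsion p → Prop := fun x => ∀ k : ℕ, ∃ y : W.geomPrimaryTorsion p,
    (∀ i ∈ (adicCompletionPrime K v).inertia (absoluteGaloisGroup K), i • y = y) ∧ p ^ k • y = x
  have hstep : ∀ x, P x → ∃ y, p • y = x ∧ P y := fun x hx => by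
    obtain ⟨y, hy, hpy⟩ := exists_core_nsmul_eq_of_core W p hx
    exact ⟨y, hpy, hy⟩
  let step : {x // P x} → {x // P x} := fun x =>
    ⟨Classical.choose (hstep x.1 x.2), (Classical.choose_spec (hstep x.1 x.2)).2⟩
  have hstep' : ∀ x : {x // P x}, p • (step x).1 = x.1 := fun x =>
    (Classical.choose_spec (hstep x.1 x.2)).1
  let s : ℕ → {x // P x} := fun n => Nat.rec ⟨x, hx⟩ (fun _ x => step x) n
  exact ⟨fun n => (s n).1, rfl, fun n => hstep' (s n), fun n => (s n).2⟩

end Core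

/-! ### §2 `π_n(T_pE^{I}) = core[p^n]` -/

section Tate

variable {v : HeightOneSpectrum (𝓞 K)}

omit [NumberField K] [W.IsElliptic] hp in
/-- `p^k • a_{n+k} = a_n` for a Tate vector `a`. [folklore] -/
theorem pow_smul_proj_add (a : W.tateModule p) (n k : ℕ) :
    p ^ k • TateModule.proj p (n + k) a = TateModule.proj p n a := by
  induction k with
  | zero => rw [pow_zero, one_smul, add_zero]
  | succ k ih =>
    rw [pow_succ, mul_smul, ← add_assoc, TateModule.smul_proj_succ, ih]

omit [W.IsElliptic] hp in
/-- **`π_n(T_pE^{I}) ⊆ core[p^n]`**: the level-`n` value of an `I`-fixed Tate vector is a core point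
(its `p^k`-th roots are the higher levels `a_{n+k}`). [cite: Rubin2000, Lemma 1.3.2] -/
theorem core_proj_of_inertia_smul_eq (a : W.tateModule p)
    (ha : ∀ i ∈ (adicCompletionPrime K v).inertia (absoluteGaloisGroup K), i • a = a) (n : ℕ) :
    ∀ k : ℕ, ∃ y : W.geomPrimaryTorsion p,
      (∀ i ∈ (adicCompletionPrime K v).inertia (absoluteGaloisGroup K), i • y = y) ∧
        p ^ k • y = ⟨TateModule.proj p n a,
          (AddCommGroup.mem_primaryComponent).mpr ⟨n, TateModule.pow_smul_proj n a⟩⟩ := by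
  intro k
  refine ⟨⟨TateModule.proj p (n + k) a,
    (AddCommGroup.mem_primaryComponent).mpr ⟨n + k, TateModule.pow_smul_proj (n + k) a⟩⟩,
    fun i hi => Subtype.ext ?_, Subtype.ext ?_⟩
  · rw [primaryComponent.coe_smul]
    change i • TateModule.proj p (n + k) a = TateModule.proj p (n + k) a
    rw [← TateModule.proj_smul_of_distribMulAction, ha i hi]
  · change p ^ k • TateModule.proj p (n + k) a = TateModule.proj p n a
    exact pow_smul_proj_add W p a n k

/-- **`core[p^n] ⊆ π_n(T_pE^{I})`**: a core point killed by `p^n` is the level-`n` value of an `I`-fixed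
Tate vector (`a_m = p^n • s_m` along a compatible core root sequence `s` of `x`, `exists_divSeq_of_core`).
[cite: Rubin2000, Lemma 1.3.2] [cite: GreenbergLNM1716, §3 Lemma 3.3 (p. 87) with the remark after its proof (p. 88)] -/
theorem exists_tate_proj_eq_of_core {x : W.geomPrimaryTorsion p}
    (hx : ∀ k : ℕ, ∃ y : W.geomPrimaryTorsion p,
      (∀ i ∈ (adicCompletionPrime K v).inertia (absoluteGaloisGroup K), i • y = y) ∧ p ^ k • y = x)
    {n : ℕ} (hxn : p ^ n • x = 0) :
    ∃ a : W.tateModule p,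
      (∀ i ∈ (adicCompletionPrime K v).inertia (absoluteGaloisGroup K), i • a = a) ∧
        TateModule.proj p n a = x := by
  obtain ⟨s, hs0, hs, hsc⟩ := exists_divSeq_of_core W p hx
  -- `p^m • s m = x`
  have hspow : ∀ m, p ^ m • s m = x := by
    intro m
    induction m with
    | zero => rw [pow_zero, one_smul, hs0]
    | succ m ih => rw [pow_succ, mul_smul, hs m, ih]
  have hsI : ∀ m, ∀ i ∈ (adicCompletionPrime K v).inertia (absoluteGaloisGroup K), i • s m = s m :=
    fun m i hi => smul_eq_of_core W p (hsc m) hi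
  let a : W.tateModule p := TateModule.mk (fun m => p ^ n • ((s m : W.geomPrimaryTorsion p) : geomPoints W))
    (fun m => by
      rw [smul_comm]
      have h := congrArg (fun z : W.geomPrimaryTorsion p => (z : geomPoints W)) (hspow m)
      simp only [AddSubmonoidClass.coe_nsmul] at h
      rw [h]
      have h0 := congrArg (fun z : W.geomPrimaryTorsion p => (z : geomPoints W)) hxn
      simpa only [AddSubmonoidClass.coe_nsmul, ZeroMemClass.coe_zero] using h0)
    (fun m => by
      rw [smul_comm]
      have h := congrArg (fun z : W.geomPrimaryTorsion p => (z : geomPoints W)) (hs m)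
      simp only [AddSubmonoidClass.coe_nsmul] at h
      rw [h])
  have ha : ∀ m, TateModule.proj p m a = p ^ n • ((s m : W.geomPrimaryTorsion p) : geomPoints W) :=
    fun m => rfl
  refine ⟨a, fun i hi => TateModule.ext fun m => ?_, ?_⟩
  · rw [TateModule.proj_smul_of_distribMulAction, ha, smul_comm]
    have h := congrArg (fun z : W.geomPrimaryTorsion p => (z : geomPoints W)) (hsI m i hi)
    rw [primaryComponent.coe_smul] at h
    rw [h]
  · rw [ha]
    have h := congrArg (fun z : W.geomPrimaryTorsion p => (z : geomPoints W)) (hspow n)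
    simpa only [AddSubmonoidClass.coe_nsmul] using h

end Tate


end Summit.BirchSwinnertonDyer.BirchSwinnertonDyer.Theorems.KimAtThreeD7uTamagawaCore

end
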